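import Mathlib
import Summits.Ventures.PercRepro2.TypedSepTwoBSupport
import Summits.Ventures.PercRepro2.TypedSepTwoOStates

/-!
# The typed (SEP-2) zero, II′ (a₃ on the o-side): the split and the states of the support (blind
cell PercRepro2, p3 g6, 2026-08-25; `proofs/P3-BRIDGE.md` §11.22)

`SplitO` : the roots `a₁, a₂` are the doors separating the o-side `WO ∋ o, a₃` from the b-side
`WB ∋ b`.  The o-side state is `SepThree.bSt` with `o` in the b-slot (the connections among
`a₁, a₂, a₃, o` inside `WO`), the b-side state is `SepTwo.oSt2` with `b` in the o-slot (`a₁~b`,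
`a₂~b`, `a₁~a₂` inside `WB`).  The two-door closure lemmas give the seven coordinates and
`st_eq_sepOSt`.  Own work; standard axioms.
-/

namespace Summit.Ventures.PercRepro2

open UnionCluster

namespace CovForm

namespace SepTwo

open OneTyped TypedA3 Untouched TypedFactor Separated RootBridge SepThree

section SupportO

open Classical

variable {V : Type*} {E : Type*} [Fintype E] [DecidableEq E]
variable (ends : E → Sym2 V) (o a₁ a₂ a₃ b : V)

/-- **The (SEP-2) split with `a₃` on the o-side**: the roots `a₁, a₂` separate the o-side
`WO ∋ o, a₃` from the b-side `WB ∋ b` in the support `z ∪ F`. -/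
structure SplitO (WO WB : Set V) (F : Finset E) (z : Config E) : Prop where
  split : ∀ e, zF F z e = true → e ∈ within ends WO ∨ e ∈ within ends WB
  cap : ∀ t, t ∈ WO → t ∈ WB → t = a₁ ∨ t = a₂
  noloop : ∀ e ∈ F, ¬ (e ∈ within ends WO ∧ e ∈ within ends WB)
  oO : o ∈ WO
  a3O : a₃ ∈ WO
  a1O : a₁ ∈ WO
  a1B : a₁ ∈ WB
  a2O : a₂ ∈ WO
  a2B : a₂ ∈ WB
  bB : b ∈ WB
  o1 : o ≠ a₁
  o2 : o ≠ a₂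
  a31 : a₃ ≠ a₁
  a32 : a₃ ≠ a₂
  b1 : b ≠ a₁
  b2 : b ≠ a₂

variable {ends o a₁ a₂ a₃ b}
variable {WO WB : Set V} {F : Finset E} {z : Config E}

omit [Fintype E] in
/-- A configuration below `z ∪ F` has its open edges within a side. -/
lemma splitO_of_le (h : SplitO ends o a₁ a₂ a₃ b WO WB F z) {x : Config E} (hx : x ≤ zF F z) :
    ∀ e, x e = true → e ∈ within ends WO ∨ e ∈ within ends WB := fun e he =>
  h.split e (by have := hx e; rw [he] at this; exact Bool.eq_true_of_true_le this)

/-! ### The seven coordinates -/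

section CoordsO

variable (h : SplitO ends o a₁ a₂ a₃ b WO WB F z) {x : Config E}
  (hsp : ∀ e, x e = true → e ∈ within ends WO ∨ e ∈ within ends WB)

omit [Fintype E] in
include h in
/-- The doors from the b-side. -/
lemma capO' : ∀ t, t ∈ WB → t ∈ WO → t = a₁ ∨ t = a₂ := fun t h1 h2 => h.cap t h2 h1

omit [Fintype E] in
include h hsp in
/-- `a₂ ~ a₁ = X ∨ h₁₂` (b-side bit first). -/
lemma conn_a2a1O : Conn ends x a₂ a₁ ↔
    Conn ends (withinRestr ends WB x) a₁ a₂ ∨ Conn ends (withinRestr ends WO x) a₂ a₁ := by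
  have hd := conn_doors ends hsp h.cap h.a1O h.a1B (s₂ := a₂) (x := x)
  constructor
  · intro hc
    rcases hd.1 (conn_symm hc) with hO | hB
    · exact Or.inr (conn_symm hO)
    · exact Or.inl hB
  · rintro (hB | hO)
    · exact conn_symm (hd.2 (Or.inr hB))
    · exact conn_symm (hd.2 (Or.inl (conn_symm hO)))

omit [Fintype E] in
include h hsp in
/-- `a₁ ~ a₂` globally, in the door form. -/
lemma conn_a1a2O : Conn ends x a₁ a₂ ↔
    Conn ends (withinRestr ends WB x) a₁ a₂ ∨ Conn ends (withinRestr ends WO x) a₂ a₁ := by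
  rw [← conn_a2a1O h hsp]
  exact ⟨conn_symm, conn_symm⟩

omit [Fintype E] in
include h hsp in
/-- `a₁ ~ o = o₁ ∨ (D ∧ (o₂ ∨ (h₁₂ ∧ o₁)))`. -/
lemma conn_a1oO : Conn ends x a₁ o ↔
    Conn ends (withinRestr ends WO x) a₁ o ∨
      ((Conn ends (withinRestr ends WB x) a₁ a₂ ∨ Conn ends (withinRestr ends WO x) a₂ a₁) ∧
        (Conn ends (withinRestr ends WO x) a₂ o ∨
          (Conn ends (withinRestr ends WO x) a₂ a₁ ∧ Conn ends (withinRestr ends WO x) a₁ o))) := by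
  have hin := conn_inside ends hsp h.cap h.a1O h.a1B h.a2O h.a2B h.a1O h.oO
  rw [conn_a1a2O h hsp] at hin
  rw [hin]
  constructor
  · rintro (hc | ⟨hD, ⟨_, h2o⟩ | ⟨h12, h1o⟩⟩)
    · exact Or.inl hc
    · exact Or.inr ⟨hD, Or.inl h2o⟩
    · exact Or.inr ⟨hD, Or.inr ⟨conn_symm h12, h1o⟩⟩
  · rintro (hc | ⟨hD, h2o | ⟨h21, h1o⟩⟩)
    · exact Or.inl hc
    · exact Or.inr ⟨hD, Or.inl ⟨conn_refl _ _ _, h2o⟩⟩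
    · exact Or.inr ⟨hD, Or.inr ⟨conn_symm h21, h1o⟩⟩

omit [Fintype E] in
include h hsp in
/-- `a₂ ~ o = o₂ ∨ (D ∧ ((h₁₂ ∧ o₂) ∨ o₁))`. -/
lemma conn_a2oO : Conn ends x a₂ o ↔
    Conn ends (withinRestr ends WO x) a₂ o ∨
      ((Conn ends (withinRestr ends WB x) a₁ a₂ ∨ Conn ends (withinRestr ends WO x) a₂ a₁) ∧
        ((Conn ends (withinRestr ends WO x) a₂ a₁ ∧ Conn ends (withinRestr ends WO x) a₂ o) ∨
          Conn ends (withinRestr ends WO x) a₁ o)) := by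
  have hin := conn_inside ends hsp h.cap h.a1O h.a1B h.a2O h.a2B h.a2O h.oO
  rw [conn_a1a2O h hsp] at hin
  rw [hin]
  constructor
  · rintro (hc | ⟨hD, ⟨h21, h2o⟩ | ⟨_, h1o⟩⟩)
    · exact Or.inl hc
    · exact Or.inr ⟨hD, Or.inl ⟨h21, h2o⟩⟩
    · exact Or.inr ⟨hD, Or.inr h1o⟩
  · rintro (hc | ⟨hD, ⟨h21, h2o⟩ | h1o⟩)
    · exact Or.inl hc
    · exact Or.inr ⟨hD, Or.inl ⟨h21, h2o⟩⟩
    · exact Or.inr ⟨hD, Or.inr ⟨conn_refl _ _ _, h1o⟩⟩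

omit [Fintype E] in
include h hsp in
/-- `a₁ ~ b = b₁ ∨ (D ∧ (b₂ ∨ (X ∧ b₁)))`. -/
lemma conn_a1bO : Conn ends x a₁ b ↔
    Conn ends (withinRestr ends WB x) a₁ b ∨
      ((Conn ends (withinRestr ends WB x) a₁ a₂ ∨ Conn ends (withinRestr ends WO x) a₂ a₁) ∧
        (Conn ends (withinRestr ends WB x) a₂ b ∨
          (Conn ends (withinRestr ends WB x) a₁ a₂ ∧ Conn ends (withinRestr ends WB x) a₁ b))) := by
  have hin := conn_inside ends (hsp' hsp) (capO' h) h.a1B h.a1O h.a2B h.a2O h.a1B h.bB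
  rw [conn_a1a2O h hsp] at hin
  rw [hin]
  constructor
  · rintro (hc | ⟨hD, ⟨_, h2b⟩ | ⟨hX, h1b⟩⟩)
    · exact Or.inl hc
    · exact Or.inr ⟨hD, Or.inl h2b⟩
    · exact Or.inr ⟨hD, Or.inr ⟨hX, h1b⟩⟩
  · rintro (hc | ⟨hD, h2b | ⟨hX, h1b⟩⟩)
    · exact Or.inl hc
    · exact Or.inr ⟨hD, Or.inl ⟨conn_refl _ _ _, h2b⟩⟩
    · exact Or.inr ⟨hD, Or.inr ⟨hX, h1b⟩⟩

omit [Fintype E] in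
include h hsp in
/-- `a₂ ~ b = b₂ ∨ (D ∧ ((X ∧ b₂) ∨ b₁))`. -/
lemma conn_a2bO : Conn ends x a₂ b ↔
    Conn ends (withinRestr ends WB x) a₂ b ∨
      ((Conn ends (withinRestr ends WB x) a₁ a₂ ∨ Conn ends (withinRestr ends WO x) a₂ a₁) ∧
        ((Conn ends (withinRestr ends WB x) a₁ a₂ ∧ Conn ends (withinRestr ends WB x) a₂ b) ∨
          Conn ends (withinRestr ends WB x) a₁ b)) := by
  have hin := conn_inside ends (hsp' hsp) (capO' h) h.a1B h.a1O h.a2B h.a2O h.a2B h.bB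
  rw [conn_a1a2O h hsp] at hin
  rw [hin]
  constructor
  · rintro (hc | ⟨hD, ⟨h21, h2b⟩ | ⟨_, h1b⟩⟩)
    · exact Or.inl hc
    · exact Or.inr ⟨hD, Or.inl ⟨conn_symm h21, h2b⟩⟩
    · exact Or.inr ⟨hD, Or.inr h1b⟩
  · rintro (hc | ⟨hD, ⟨hX, h2b⟩ | h1b⟩)
    · exact Or.inl hc
    · exact Or.inr ⟨hD, Or.inl ⟨conn_symm hX, h2b⟩⟩
    · exact Or.inr ⟨hD, Or.inr ⟨conn_refl _ _ _, h1b⟩⟩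

omit [Fintype E] in
include h hsp in
/-- `a₁ ~ a₃ = Y ∨ (D ∧ (h₃₂ ∨ (h₁₂ ∧ Y)))`. -/
lemma conn_a1a3O : Conn ends x a₁ a₃ ↔
    Conn ends (withinRestr ends WO x) a₁ a₃ ∨
      ((Conn ends (withinRestr ends WB x) a₁ a₂ ∨ Conn ends (withinRestr ends WO x) a₂ a₁) ∧
        (Conn ends (withinRestr ends WO x) a₂ a₃ ∨
          (Conn ends (withinRestr ends WO x) a₂ a₁ ∧
            Conn ends (withinRestr ends WO x) a₁ a₃))) := by
  have hin := conn_inside ends hsp h.cap h.a1O h.a1B h.a2O h.a2B h.a1O h.a3O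
  rw [conn_a1a2O h hsp] at hin
  rw [hin]
  constructor
  · rintro (hc | ⟨hD, ⟨_, h23⟩ | ⟨h12, h13⟩⟩)
    · exact Or.inl hc
    · exact Or.inr ⟨hD, Or.inl h23⟩
    · exact Or.inr ⟨hD, Or.inr ⟨conn_symm h12, h13⟩⟩
  · rintro (hc | ⟨hD, h23 | ⟨h21, h13⟩⟩)
    · exact Or.inl hc
    · exact Or.inr ⟨hD, Or.inl ⟨conn_refl _ _ _, h23⟩⟩
    · exact Or.inr ⟨hD, Or.inr ⟨conn_symm h21, h13⟩⟩

omit [Fintype E] in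
include h hsp in
/-- `a₂ ~ a₃ = h₃₂ ∨ (D ∧ ((h₁₂ ∧ h₃₂) ∨ Y))`. -/
lemma conn_a2a3O : Conn ends x a₂ a₃ ↔
    Conn ends (withinRestr ends WO x) a₂ a₃ ∨
      ((Conn ends (withinRestr ends WB x) a₁ a₂ ∨ Conn ends (withinRestr ends WO x) a₂ a₁) ∧
        ((Conn ends (withinRestr ends WO x) a₂ a₁ ∧ Conn ends (withinRestr ends WO x) a₂ a₃) ∨
          Conn ends (withinRestr ends WO x) a₁ a₃)) := by
  have hin := conn_inside ends hsp h.cap h.a1O h.a1B h.a2O h.a2B h.a2O h.a3O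
  rw [conn_a1a2O h hsp] at hin
  rw [hin]
  constructor
  · rintro (hc | ⟨hD, ⟨h21, h23⟩ | ⟨_, h13⟩⟩)
    · exact Or.inl hc
    · exact Or.inr ⟨hD, Or.inl ⟨h21, h23⟩⟩
    · exact Or.inr ⟨hD, Or.inr h13⟩
  · rintro (hc | ⟨hD, ⟨h21, h23⟩ | h13⟩)
    · exact Or.inl hc
    · exact Or.inr ⟨hD, Or.inl ⟨h21, h23⟩⟩
    · exact Or.inr ⟨hD, Or.inr ⟨conn_refl _ _ _, h13⟩⟩

end CoordsO

omit [Fintype E] in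
/-- **The state of a copy of the support is the gluing of its side states.** -/
theorem st_eq_sepOSt (h : SplitO ends o a₁ a₂ a₃ b WO WB F z) {x : Config E}
    (hx : x ≤ zF F z) :
    st ends o a₁ a₂ a₃ b x = gluedO (oSt2 ends b a₁ a₂ WB x) (bSt ends a₁ a₂ a₃ o WO x) := by
  have hsp := splitO_of_le h hx
  have e1 := conn_a2a1O h hsp
  have e2 := conn_a1oO h hsp
  have e3 := conn_a2oO h hsp
  have e4 := conn_a1bO h hsp
  have e5 := conn_a2bO h hsp
  have e6 := conn_a1a3O h hsp
  have e7 := conn_a2a3O h hsp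
  unfold st gluedO oSt2 bSt
  rw [decide_eq_decide.mpr e1, decide_eq_decide.mpr e2, decide_eq_decide.mpr e3,
    decide_eq_decide.mpr e4, decide_eq_decide.mpr e5, decide_eq_decide.mpr e6,
    decide_eq_decide.mpr e7]
  simp only [Bool.decide_or, Bool.decide_and]
  all_goals infer_instance

end SupportO

end SepTwo

end CovForm

end Summit.Ventures.PercRepro2
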